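import Literature.AlgebraicGeometry.ComplexMultiplication.TateModuleOfCMFreeRankOne
import HarnessLib

/-!
# Eigenvectors of an INTEGRAL action on `(V_ℓ B)^∨` are eigenvectors of the RATIONAL action it generates

Topic `AlgebraicGeometry/ComplexMultiplication`; namespace `Literature.AlgebraicGeometry.Motives.AbelianVariety` (the home of ★
`rationalTateAction`, same file family as ★ `TateModuleOfCMFreeRankOne`).  THEOREMS ONLY (no definition, no named fact, no instance, no
`sorry`); inputs: ★ `AbelianVariety.rationalTateAction B ℓ : B.endAlgebra →+* Module.End ℚ_[ℓ] (V_ℓ B)` with `rationalTateAction_of`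
([SerreTate1968] §4), Mathlib `IsFractionRing.div_surjective`.

## What is proved

Let `B` be an abelian variety over a field, `R` a commutative ring with fraction field `M` (`[IsFractionRing R M]`, e.g. `R = 𝓞 M` or
an order, `M` a number field), `ρ : R →+* End B` an INTEGRAL action and `i : M →+* End⁰(B) = B.endAlgebra` a RATIONAL action extending
it (`i (algebraMap R M r) = 1 ⊗ ρ r`).  Let `R′` be any commutative `ℚ_ℓ`-algebra (e.g. `ℚ_ℓ^{ac}`), `e : M →+* R′` a character
(e.g. `ι′ ∘ τ`), and `f ∈ R′ ⊗ (V_ℓ B)^∨` a simultaneous eigenvector of the transposed integral action: `(1 ⊗ ᵗV_ℓ(ρ r)) f = e(r) • f`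
for all `r ∈ R`.  THEN `f` is an eigenvector of the whole rational action: `(1 ⊗ ᵗ(rationalTateAction (i a))) f = e(a) • f` for every
`a ∈ M` (`dualMap_rationalTateAction_baseChange_eq_smul_of_integral`).  Proof: `a = r/s`, `i a · (1 ⊗ ρ s) = 1 ⊗ ρ r`; transposing,
`e(s) • (ᵗ(i a)) f = e(r) • f` (the two operators commute, `M` being commutative), and `e(s)` is a unit (`s ≠ 0` in the field `M`).

DICTIONARY LINE (cell `hodgecm-mathlib`, crux `HLiu418` = stmt-HodgeConjecture-24832, d6 HOME card S2′ `stub_d6_cmIsotypicQuotient`):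
this is EXACTLY the eigen-hypothesis shape of ★ `Sec42Data.exists_heckeCharacter_towerRep_eq_inv_smul_of_ringHom'`
(`AppendixC/EtaleH1TowerCMQuotient`, edition 2), produced from the integral data the S2 hand actually holds (Hecke correspondences as honest
endomorphisms, ★ `AppendixC/EtaleH1TowerHeckeEndomorphism`, restricted to the idempotent image, ★ `Motives/AbelianVarietyQuasiIdempotentImageDual`
+ `imageAction`).  The file moves no book (HC_CM is proved only modulo the 7 printed citations until rung 0 closes).

## References
* [SerreTate1968] J.-P. Serre, J. Tate, *Good reduction of abelian varieties*, Ann. of Math. 88 (1968), §4 (the map `ℚ_ℓ ⊗ End(A) → End(V_ℓ)`).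
* [MumfordAV1970] D. Mumford, *Abelian Varieties* (1970), §19 Thm. 3 (p. 176) (`End⁰(A) = ℚ ⊗ End A` acting on `V_ℓ`).
-/

set_option autoImplicit false

noncomputable section

open CategoryTheory
open scoped TensorProduct nonZeroDivisors

universe u

namespace Literature.AlgebraicGeometry.Motives

namespace AbelianVariety

variable {K : Type u} [Field K] (B : AbelianVariety K) (ℓ : ℕ) [Fact ℓ.Prime]
variable {R M : Type} [CommRing R] [Field M] [Algebra R M] [IsFractionRing R M]

omit [IsFractionRing R M] in
/-- **The rational action extends the integral one on `V_ℓ`**: `V_ℓ(i (r/1)) = V_ℓ(ρ r)` when `i ∘ algebraMap = 1 ⊗ ρ`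
(★ `rationalTateAction_of`). [cite: SerreTate1968, §4 (proof of Thm. 5)] -/
theorem rationalTateAction_algebraMap_eq_of_integral (ρ : R →+* End B) (i : M →+* B.endAlgebra)
    (hi : ∀ r : R, i (algebraMap R M r) = endAlgebra.of B (ρ r)) (r : R) :
    rationalTateAction B ℓ (i (algebraMap R M r)) = rationalTateModuleMap ℓ (ρ r : B ⟶ B) := by
  rw [hi, rationalTateAction_of]

/-- **Eigenvectors of the transposed INTEGRAL action are eigenvectors of the transposed RATIONAL action** (see the module docstring):
if `(1 ⊗ ᵗV_ℓ(ρ r)) f = e(r) • f` for all `r ∈ R` then `(1 ⊗ ᵗ(rationalTateAction (i a))) f = e(a) • f` for all `a ∈ M = Frac R`.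
[cite: SerreTate1968, §4 (proof of Thm. 5)] [cite: MumfordAV1970, §19 Thm. 3 (p. 176)] -/
theorem dualMap_rationalTateAction_baseChange_eq_smul_of_integral (ρ : R →+* End B) (i : M →+* B.endAlgebra)
    (hi : ∀ r : R, i (algebraMap R M r) = endAlgebra.of B (ρ r))
    (R' : Type) [CommRing R'] [Algebra ℚ_[ℓ] R'] (e : M →+* R') (f : R' ⊗[ℚ_[ℓ]] Module.Dual ℚ_[ℓ] (B.rationalTateModule ℓ))
    (hf : ∀ r : R, ((rationalTateModuleMap ℓ (ρ r : B ⟶ B)).dualMap).baseChange R' f = e (algebraMap R M r) • f) (a : M) :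
    ((rationalTateAction B ℓ (i a)).dualMap).baseChange R' f = e a • f := by
  -- write `a = r / s` with `s` a non-zero-divisor of `R`
  obtain ⟨r, s, hs, rfl⟩ := IsFractionRing.div_surjective (A := R) a
  haveI : Nontrivial R := (algebraMap R M).domain_nontrivial
  have hs0 : (algebraMap R M s) ≠ 0 := IsFractionRing.to_map_ne_zero_of_mem_nonZeroDivisors hs
  have hunit : IsUnit (e (algebraMap R M s)) := (IsUnit.mk0 _ hs0).map e
  -- abbreviations: the transposed, base-changed operators
  set Ta : R' ⊗[ℚ_[ℓ]] Module.Dual ℚ_[ℓ] (B.rationalTateModule ℓ) →ₗ[R'] _ :=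
    ((rationalTateAction B ℓ (i (algebraMap R M r / algebraMap R M s))).dualMap).baseChange R' with hTa
  set Ts : R' ⊗[ℚ_[ℓ]] Module.Dual ℚ_[ℓ] (B.rationalTateModule ℓ) →ₗ[R'] _ :=
    ((rationalTateAction B ℓ (i (algebraMap R M s))).dualMap).baseChange R' with hTs
  -- `i(s) · i(a) = i(r)` in `End⁰(B)` (commutativity of `M`), read on `V_ℓ` and transposed: `Ta (Ts f) = ᵗV(ρ r) f = e(r) • f`
  have hmul' : i (algebraMap R M s) * i (algebraMap R M r / algebraMap R M s) = i (algebraMap R M r) := by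
    rw [← map_mul, mul_div_cancel₀ _ hs0]
  have key : ∀ {x y : M}, i x * i y = i (algebraMap R M r) →
      ((rationalTateAction B ℓ (i y)).dualMap).baseChange R' (((rationalTateAction B ℓ (i x)).dualMap).baseChange R' f) =
        e (algebraMap R M r) • f := by
    intro x y hxy
    have h1 : rationalTateAction B ℓ (i x) * rationalTateAction B ℓ (i y) = rationalTateModuleMap ℓ (ρ r : B ⟶ B) := by
      rw [← map_mul, hxy, rationalTateAction_algebraMap_eq_of_integral B ℓ ρ i hi r]
    have h2 : (rationalTateAction B ℓ (i y)).dualMap ∘ₗ (rationalTateAction B ℓ (i x)).dualMap =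
        (rationalTateModuleMap ℓ (ρ r : B ⟶ B)).dualMap := by
      rw [LinearMap.dualMap_comp_dualMap, ← h1]
      rfl
    have := congrArg (fun (L : Module.Dual ℚ_[ℓ] (B.rationalTateModule ℓ) →ₗ[ℚ_[ℓ]] _) => (L.baseChange R') f) h2
    simpa only [LinearMap.baseChange_comp, LinearMap.comp_apply, hf r] using this
  -- `Ts f = e(s) • f` (the integral eigen-relation at `s`) and `Ta (Ts f) = e(r) • f`
  have hTsf : Ts f = e (algebraMap R M s) • f := by
    rw [hTs, rationalTateAction_algebraMap_eq_of_integral B ℓ ρ i hi s]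
    exact hf s
  have hTaTs : Ta (Ts f) = e (algebraMap R M r) • f := key hmul'
  -- hence `e(s) • Ta f = e(r) • f`, and `e(s)` is a unit
  have h3 : e (algebraMap R M s) • Ta f = e (algebraMap R M r) • f := by
    rw [← hTaTs, hTsf, map_smul]
  have her : e (algebraMap R M r) = e (algebraMap R M s) * e (algebraMap R M r / algebraMap R M s) := by
    rw [← map_mul, mul_div_cancel₀ _ hs0]
  exact (IsUnit.smul_left_cancel hunit).1 (by rw [h3, her, mul_smul])

end AbelianVariety

end Literature.AlgebraicGeometry.Motives

end
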